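import Summits.BirchSwinnertonDyer.BirchSwinnertonDyer.Theorems.KatoDescentTamePotSupersingularCartanMuRoadDoorsTprimeFive
import Literature.NumberTheory.EllipticCurves.FineSelmerRankEqualitySplitCartanFive
import Literature.NumberTheory.EllipticCurves.FineSelmerRankEqualityZywinaG9Five
import Literature.NumberTheory.EllipticCurves.FineSelmerLayerZeroDoorOfNegOneInertia
import HarnessLib

/-!
# Route `KatoDescentTamePotSupersingular` (rung K8, sub-rung B4 (t′), cell `bsd-potss`): U₀ DOORS at the `5Ns` and `5S4` rows FROM THE LAYER-0
# ISOTYPIC INPUT (c2*)₀ + the displayed inertia input `−1 ∈ I(𝔮|5)`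

Seat `bsd-potss-k8t-c4` g26; `--supports stmt-BirchSwinnertonDyer-19982 --as helper`. THEOREMS ONLY (no definition, no named fact, no `sorry`);
nothing booked; (A), Conjecture A and BSD are proved for NO curve here; items 19202 / 19982 stay OPEN at class level (open inputs class-wide: zeta
crux 24439, lower half of 19984).

For the `5Ns` / `5S4` rows where the rank-equality road is shut (`rank_5 Cl(ℚ(P)) > rank_5 Cl(ℚ(x(P)))`: 235200xb1, 338800ex1; 110450bj1, 129600gm1,
259200gq1, 259200h1 — kit j333447 / j333564) the weaker LAYER-0 ISOTYPIC input (c2*)₀ «every additive `Γ_ℚ`-equivariant `Cl(𝓞_{ℚ(E[5])}) → E[5]` is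
zero» may still hold (when the extra classes live in a constituent `≠ E[5]`).  Image-agnostic Literature road (k8t-c4 g26,
`CoatesSujatha2005.RankEqualityRoad.conjA_of_homTrivial_layerZero_of_neg_one_mem_inertia`: door L6 in inertia form + door L5), with `σ_m = σ_u²σ_v²`
(full `C_s⁺(5)`) resp. `σ_m = σ_w²` (`G₉`) acting as `−1`, (c1) from the image (`not_five_dvd_card_gal_of_splitCartanNormalizer` / `…_of_zywinaG9`):

§1 `missingUpperBoundAt_five_tame_of_splitCartanBasis_of_homTrivial_layerZero` — displayed: basis data, `hcI`, `h0`;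
§2 `missingUpperBoundAt_five_tame_of_zywinaG9Basis_of_homTrivial_layerZero` — displayed: basis data, `hcI`, `h0`.
CONDITIONAL; per row; nothing booked; BSD for no curve.

References: [Kato2004Asterisque] Thm. 14.5 (3); [CoatesSujatha2005] Thm. 3.4; [DeoRaySujatha2023] Thm. 3.8; [Washington1997] §13; [Zywina2015] §1.3.
-/

set_option autoImplicit false
-- the Theorems directory repeats the summit name (`Summits/BirchSwinnertonDyer/BirchSwinnertonDyer/…`): house rule of the cell
set_option linter.dupNamespace false

noncomputable section

open scoped Classical NumberField Matrix
open WeierstrassCurve Field IntermediateField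
  Literature.NumberTheory.EllipticCurves Literature.NumberTheory.EllipticCurves.Rank1Residual
  Literature.NumberTheory.EllipticCurves.Rank1Residual.Typed
  Literature.NumberTheory.GaloisRepresentations Literature.NumberTheory.SerreUniformity
  Literature.NumberTheory.IwasawaTheory Literature.NumberTheory.NumberFields Literature.NumberTheory.EllipticCurves.Zywina2015G9
  Literature.NumberTheory.EllipticCurves.CoatesSujatha2005.RankEqualityRoad
  Summit.BirchSwinnertonDyer.Rank1Residual Summit.BirchSwinnertonDyer.Rank1Residual.Additive
  Summit.BirchSwinnertonDyer.BirchSwinnertonDyer.Theorems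

namespace Summit.BirchSwinnertonDyer.BirchSwinnertonDyer.Theorems.TameRankEqRecords

/-- `diag(2,1)² · diag(1,2)² = −1` in `GL₂(𝔽₅)`. [folklore] -/
private theorem uuvv_eq_neg_one_l0 :
    (!![2, 0; 0, 1] : Matrix (Fin 2) (Fin 2) (ZMod 5)) * !![2, 0; 0, 1] * !![1, 0; 0, 2] * !![1, 0; 0, 2] = -1 := by
  decide

/-- `(0 4; 1 0)² = −1` in `GL₂(𝔽₅)`. [folklore] -/
private theorem ww_eq_neg_one_l0 : (!![0, 4; 1, 0] : Matrix (Fin 2) (Fin 2) (ZMod 5)) * !![0, 4; 1, 0] = -1 := by decide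

/-! ### §1 Full `C_s⁺(5)` image -/

/-- **U₀ `MissingUpperBoundAt E 5` at a rank-`0` (t′) row with image `C_s⁺(5)` FROM THE LAYER-0 ISOTYPIC INPUT** — the named facts `hKatoA hGZK hmod`,
Cremona's `r_an = 0`, `Addv E 5`, `SubTprime E 5`, `E[5]` irreducible, the `C_s⁺(5)` data (`e he σu σv hσu hσv`, displayed), the inertia
input `hcI : σ̄_u²σ̄_v² ∈ I(𝔮)` for every prime `𝔮 ∋ 5` of `ℚ(E[5])` (displayed) and the layer-0 isotypic input `h0` (displayed).  NO `μ`-hypothesis, no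
class-number equality.  `conjA_of_homTrivial_layerZero_of_neg_one_mem_inertia` ∘ `CartanMuRoadDoorsTprimeFive.missingUpperBoundAt_tame_of_conjA`.
CONDITIONAL; nothing booked; BSD for no curve. [cite: Kato2004Asterisque, Thm. 14.5 (3) (p. 236)] [cite: CoatesSujatha2005, §3 Thm. 3.4]
[cite: DeoRaySujatha2023, §3 Thm. 3.8 (arXiv:2202.09937 p. 9)] -/
theorem missingUpperBoundAt_five_tame_of_splitCartanBasis_of_homTrivial_layerZero (W : WeierstrassCurve ℚ) [W.IsElliptic] [W.IsGloballyMinimal]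
    (hKatoA : Kato2004.rankZero_padicValNat_sha_add_padicValNat_tamagawa_le_of_additive_potGood_of_irreducible_of_fineSelmerDual_fg)
    (hGZK : rank_eq_analyticRank_of_analyticRank_le_one) (hmod : hasEntireLFunction_rat)
    (hr : W.analyticRank = 0) (hadd : haveI : Fact (Nat.Prime 5) := ⟨by norm_num⟩; Addv W 5)
    (hT : haveI : Fact (Nat.Prime 5) := ⟨by norm_num⟩; SubTprime W 5)
    (hirr : haveI : Fact (Nat.Prime 5) := ⟨by norm_num⟩; W.HasIrreducibleModPGaloisRep 5)
    (e : W.geomTorsion (5 : ℕ) ≃+ (Fin 2 → ZMod 5))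
    (he : ∀ σ : absoluteGaloisGroup ℚ, ∃ M ∈ splitCartanNormalizer 5, ∀ P : W.geomTorsion (5 : ℕ), e (σ • P) = M *ᵥ e P)
    (σu σv : absoluteGaloisGroup ℚ) (hσu : ∀ P : W.geomTorsion (5 : ℕ), e (σu • P) = !![2, 0; 0, 1] *ᵥ e P)
    (hσv : ∀ P : W.geomTorsion (5 : ℕ), e (σv • P) = !![1, 0; 0, 2] *ᵥ e P)
    (hcI : ∀ (𝔮 : Ideal (𝓞 ↥(W.divisionField 5))) [𝔮.IsMaximal], ((5 : ℕ) : 𝓞 ↥(W.divisionField 5)) ∈ 𝔮 →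
      absRestrictNormalHom (W.divisionField 5) (σu * σu * (σv * σv)) ∈ 𝔮.inertia _)
    (h0 : ∀ μ : Additive (ClassGroup (𝓞 ↥(W.divisionField 5))) →+ W.geomTorsion (5 : ℕ),
      (∀ (τ : absoluteGaloisGroup ℚ) (c : ClassGroup (𝓞 ↥(W.divisionField 5))),
        μ (Additive.ofMul (ClassGroup.mulEquiv
          (AmbiguousClass.intAut (absRestrictNormalHom (W.divisionField 5) τ)) c)) = τ • μ (Additive.ofMul c)) → μ = 0) :
    haveI : Fact (Nat.Prime 5) := ⟨by norm_num⟩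
    MissingUpperBoundAt W 5 := by
  haveI : Fact (Nat.Prime 5) := ⟨by norm_num⟩
  have hσm : ∀ P : W.geomTorsion (5 : ℕ), (σu * σu * (σv * σv)) • P = -P := fun P => e.injective (by
    rw [map_neg, mul_smul, mul_smul, mul_smul, hσu, hσu, hσv, hσv, Matrix.mulVec_mulVec, Matrix.mulVec_mulVec, Matrix.mulVec_mulVec,
      uuvv_eq_neg_one_l0, Matrix.neg_mulVec, Matrix.one_mulVec])
  exact CartanMuRoadDoorsTprimeFive.missingUpperBoundAt_tame_of_conjA W hKatoA hGZK hmod 5 hr (by decide) hadd hT hirr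
    (conjA_of_homTrivial_layerZero_of_neg_one_mem_inertia W (by norm_num) (not_five_dvd_card_gal_of_splitCartanNormalizer W e he)
      (σu * σu * (σv * σv)) hσm hcI h0)

/-! ### §2 Zywina's `G₉` (`5S4`) -/

/-- **U₀ `MissingUpperBoundAt E 5` at a rank-`0` (t′) row with image `G₉` FROM THE LAYER-0 ISOTYPIC INPUT** — the named facts `hKatoA hGZK hmod`,
Cremona's `r_an = 0`, `Addv E 5`, `SubTprime E 5`, `E[5]` irreducible, the `G₉` data (`e he σw hσw`, displayed), the inertia input
`hcI : σ̄_w² ∈ I(𝔮)` for every prime `𝔮 ∋ 5` of `ℚ(E[5])` (displayed) and the layer-0 isotypic input `h0` (displayed).  NO `μ`-hypothesis, no class-number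
equality.  `conjA_of_homTrivial_layerZero_of_neg_one_mem_inertia` ∘ `CartanMuRoadDoorsTprimeFive.missingUpperBoundAt_tame_of_conjA`.
CONDITIONAL; nothing booked; BSD for no curve. [cite: Kato2004Asterisque, Thm. 14.5 (3) (p. 236)] [cite: CoatesSujatha2005, §3 Thm. 3.4]
[cite: Zywina2015, §1.3] -/
theorem missingUpperBoundAt_five_tame_of_zywinaG9Basis_of_homTrivial_layerZero (W : WeierstrassCurve ℚ) [W.IsElliptic] [W.IsGloballyMinimal]
    (hKatoA : Kato2004.rankZero_padicValNat_sha_add_padicValNat_tamagawa_le_of_additive_potGood_of_irreducible_of_fineSelmerDual_fg)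
    (hGZK : rank_eq_analyticRank_of_analyticRank_le_one) (hmod : hasEntireLFunction_rat)
    (hr : W.analyticRank = 0) (hadd : haveI : Fact (Nat.Prime 5) := ⟨by norm_num⟩; Addv W 5)
    (hT : haveI : Fact (Nat.Prime 5) := ⟨by norm_num⟩; SubTprime W 5)
    (hirr : haveI : Fact (Nat.Prime 5) := ⟨by norm_num⟩; W.HasIrreducibleModPGaloisRep 5)
    (e : W.geomTorsion (5 : ℕ) ≃+ (Fin 2 → ZMod 5))
    (he : ∀ σ : absoluteGaloisGroup ℚ, ∃ M ∈ G9, ∀ P : W.geomTorsion (5 : ℕ),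
      e (σ • P) = ((M : GL (Fin 2) (ZMod 5)) : Matrix (Fin 2) (Fin 2) (ZMod 5)) *ᵥ e P)
    (σw : absoluteGaloisGroup ℚ) (hσw : ∀ P : W.geomTorsion (5 : ℕ), e (σw • P) = !![0, 4; 1, 0] *ᵥ e P)
    (hcI : ∀ (𝔮 : Ideal (𝓞 ↥(W.divisionField 5))) [𝔮.IsMaximal], ((5 : ℕ) : 𝓞 ↥(W.divisionField 5)) ∈ 𝔮 →
      absRestrictNormalHom (W.divisionField 5) (σw ^ 2) ∈ 𝔮.inertia _)
    (h0 : ∀ μ : Additive (ClassGroup (𝓞 ↥(W.divisionField 5))) →+ W.geomTorsion (5 : ℕ),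
      (∀ (τ : absoluteGaloisGroup ℚ) (c : ClassGroup (𝓞 ↥(W.divisionField 5))),
        μ (Additive.ofMul (ClassGroup.mulEquiv
          (AmbiguousClass.intAut (absRestrictNormalHom (W.divisionField 5) τ)) c)) = τ • μ (Additive.ofMul c)) → μ = 0) :
    haveI : Fact (Nat.Prime 5) := ⟨by norm_num⟩
    MissingUpperBoundAt W 5 := by
  haveI : Fact (Nat.Prime 5) := ⟨by norm_num⟩
  have hσm : ∀ P : W.geomTorsion (5 : ℕ), (σw ^ 2) • P = -P := fun P => e.injective (by
    rw [map_neg, pow_two, mul_smul, hσw, hσw, Matrix.mulVec_mulVec, ww_eq_neg_one_l0, Matrix.neg_mulVec, Matrix.one_mulVec])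
  exact CartanMuRoadDoorsTprimeFive.missingUpperBoundAt_tame_of_conjA W hKatoA hGZK hmod 5 hr (by decide) hadd hT hirr
    (conjA_of_homTrivial_layerZero_of_neg_one_mem_inertia W (by norm_num) (not_five_dvd_card_gal_of_zywinaG9 W e he)
      (σw ^ 2) hσm hcI h0)

end Summit.BirchSwinnertonDyer.BirchSwinnertonDyer.Theorems.TameRankEqRecords

end
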